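import Literature.AnabelianGeometry.SemiGraphs.IncoherentBouquet
import Literature.AnabelianGeometry.SemiGraphs.TemperedGaloisCountableOfStrictlyCoherent
import HarnessLib

/-!
# The coherent ray: a connected, countable, COHERENT semi-graph of anabelioids which is NOT
# Galois-countable — "strictly" cannot be dropped in [IUTchI] Remark 2.5.3 (i) (T4)

Mochizuki, *Inter-universal Teichmüller theory I*, Rmk. 2.5.3 (i), kurims manuscript pp. 52–53
[cite: Mochizuki2012, IUTchI Rmk 2.5.3 (i) (T2)–(T4), pp. 52–53]: (T2) "a semi-graph of anabelioids
`G` is *Galois-countable* if it is countable, and, moreover, admits a countable collection of finite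
étale coverings `{G_i → G}_{i ∈ I}` such that for any finite étale covering `H → G`, there exists an
`i ∈ I` such that the base-changed covering `H ×_G G_i → G_i` splits over the constituent anabelioid
associated to each component of `G_i`"; (T3) "*strictly coherent* if it is coherent [[SemiAnbd]
Def. 2.3 (iii): quasi-coherent, and each profinite group associated to a component is topologically
finitely generated] and … topologically generated by `N` generators, for some positive integer `N`
that is independent of `c`"; (T4) "every strictly coherent, countable semi-graph of anabelioids is
Galois-countable".  Mochizuki, *Semi-graphs of anabelioids*, Publ. RIMS **42** (2006), Def. 2.3
pp. 24–25 (approximators, quasi-coherent, coherent), §3 Def. 3.5 p. 37 (finite étale coverings as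
finite objects of `B^cov(G)`) [cite: MochizukiSemiAnbd2006, Def 2.3(iii) p.25].

abc-iut cell, layer L3, route T (seat abc-iut-L3-t5), row «ROUTE-T·T4-TIGHT».  The tree PROVES (T4) in
the local presentation: `ProfiniteSemiGraph.isGaloisCountable_of_isStrictlyCoherent` (connected, has
a vertex, countable, STRICTLY coherent ⇒ Galois-countable; `TemperedGaloisCountableOfStrictlyCoherent`,
abc-iut-w4-d075).  This file shows, by an explicit COUNTERMODEL, that the uniform bound `N` of (T3)
cannot be dropped there — coherence alone (every `Π_c` topologically finitely generated, by a number
of generators depending on `c`) does NOT give (T2):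

* `coherentRay` (`𝒢_ray`): the ℕ-ray (vertices `n : ℕ`, the edge `n` joining `n` and `n + 1`) with
  vertex groups `Π_{v_n} = (ℤ/2)^{n+1}` (FINITE, hence topologically generated by `n + 1` elements),
  trivial edge groups, trivial gluings — `coherentRay_isConnected`, `_hasVertex`, `_isCountable`,
  `coherentRay_isQuasiCoherent` (approximators `Π_{v_n} → Π_{v_n}/Fix(H_n)`, orders dividing `(M!)!`),
  `coherentRay_isCoherent`;
* ★ `coherentRay_not_isGaloisCountable` — DIAGONAL ARGUMENT: let `F_i` (`i ∈ ℕ`) be finite objects of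
  `B^cov(𝒢_ray)` with nonempty fibres; `𝒢_ray` being connected, `F_i` has a constant degree `d_i`;
  choose vertices `n_0 < n_1 < ⋯` with `n_i ≥ d_i` (`sel`); since `|Π_{v_{n_i}}| = 2^{n_i+1} > d_i`, a
  point `z_i` of `F_i` over `v_{n_i}` is fixed by some `k_i ≠ 1`, and some coordinate character
  `χ_i : (ℤ/2)^{n_i+1} → ℤ/2` does not kill `k_i`; the degree-`2` covering `diagObj` (over `v_{n_i}`
  the set `ℤ/2` with `Π_{v_{n_i}}` acting through `χ_i`, any coordinate elsewhere, trivial action on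
  the edges, identity gluings) is then split by NO `F_i` (`k_i` fixes `z_i` but moves `ℤ/2`);
* `coherentRay_not_isStrictlyCoherent` (⟸ (T4) by name) and the records
  `exists_isCoherent_not_isGaloisCountable`, `not_forall_isCoherent_isGaloisCountable`.

With the incoherent bouquet `𝒢₀` of `IncoherentBouquet` (connected, countable, quasi-coherent,
Galois-countable, NOT coherent) this completes the independence of the typed hypotheses "(T2)
Galois-countable" and "coherent" for connected countable semi-graphs of anabelioids.

Honest framing: a TIGHTNESS datum about OUR typed hypotheses (DEFINITIONS of an explicit object and
its elementary properties; no statement of print is retyped, no `Prop` fact is named).  Print's (T4)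
asserts exactly the strictly coherent case, which the tree proves; nothing of print is contradicted.
`𝒢_ray` is not a Prop-3.6 object (trivial edge groups are not aloof as typed) — not claimed.  Outside
the [IUTchIII] Cor. 3.12 cone; nothing here bears on it.
-/

noncomputable section

open CategoryTheory Topology
open scoped Nat

namespace Literature.AnabelianGeometry.SemiGraphs

open Literature.AlgebraicGeometry.Frobenioids.QuasiTemperoid.BTempConnected (ρ_one_apply ρ_mul_apply)

namespace ProfiniteSemiGraph

namespace CoherentRay

open IncoherentBouquet (M charObj charObj_ρ trivialObj)

/-! ### 1. The underlying semi-graph: the ℕ-ray -/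

/-- The ℕ-ray ([SemiAnbd] §1 p. 11): vertices `n : ℕ`, edges `n : ℕ`, the edge `n` having the two
branches `(n, false)` abutting to the vertex `n` and `(n, true)` abutting to the vertex `n + 1`.
[cite: MochizukiSemiAnbd2006, §1 p.11] -/
abbrev ray : SemiGraph.{0} where
  Vertex := ℕ
  Edge := ℕ
  Branch := ℕ × Bool
  edgeOf b := b.1
  abuts b := some (b.1 + b.2.toNat)
  two_branches n := ⟨(n, false), (n, true), by simp, rfl, rfl, fun b hb => by
    obtain ⟨m, c⟩ := b
    change m = n at hb
    subst hb
    cases c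
    · exact Or.inl rfl
    · exact Or.inr rfl⟩

/-- **The coherent ray `𝒢_ray`** ([SemiAnbd] Def. 2.1 p. 22, local presentation): on the ℕ-ray, the
vertex group at `n` is `(ℤ/2)^{n+1}`, the edge groups are trivial, the gluings are the trivial
homomorphisms.  A DEFINITION (countermodel); nothing of the paper is asserted.
[cite: MochizukiSemiAnbd2006, Def 2.1 p.22] -/
@[reducible] def coherentRay : ProfiniteSemiGraph.{0} where
  graph := ray
  Gv n := Fin (n + 1) → M
  Ge _ := PUnit
  brHom _ _ _ := 1

/-- The vertex `n + 1` is reachable from the vertex `n` in the barycentric subdivision (through the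
branch `(n, false)`, the edge `n`, the branch `(n, true)`). [cite: MochizukiSemiAnbd2006, §1 p.11] -/
theorem reachable_succ (n : ℕ) : ray.subdivision.Reachable (Sum.inl n) (Sum.inl (n + 1)) := by
  have h1 : ray.subdivision.Adj (Sum.inr (Sum.inr (n, false))) (Sum.inl n) :=
    ray.subdivision_adj_of_nodeRel (SemiGraph.NodeRel.branch_vertex (G := ray) (n, false) n rfl)
  have h2 : ray.subdivision.Adj (Sum.inr (Sum.inl n)) (Sum.inr (Sum.inr (n, false))) :=
    ray.subdivision_adj_of_nodeRel (SemiGraph.NodeRel.edge_branch (G := ray) (n, false))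
  have h3 : ray.subdivision.Adj (Sum.inr (Sum.inl n)) (Sum.inr (Sum.inr (n, true))) :=
    ray.subdivision_adj_of_nodeRel (SemiGraph.NodeRel.edge_branch (G := ray) (n, true))
  have h4 : ray.subdivision.Adj (Sum.inr (Sum.inr (n, true))) (Sum.inl (n + 1)) :=
    ray.subdivision_adj_of_nodeRel (SemiGraph.NodeRel.branch_vertex (G := ray) (n, true) (n + 1) rfl)
  exact h1.symm.reachable.trans (h2.symm.reachable.trans (h3.reachable.trans h4.reachable))

/-- Every vertex is reachable from the vertex `0`. [cite: MochizukiSemiAnbd2006, §1 p.11] -/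
theorem reachable_vertex (n : ℕ) : ray.subdivision.Reachable (Sum.inl 0) (Sum.inl n) := by
  induction n with
  | zero => exact SimpleGraph.Reachable.refl _
  | succ n ih => exact ih.trans (reachable_succ n)

/-- Every node of the barycentric subdivision is reachable from the vertex `0`.
[cite: MochizukiSemiAnbd2006, §1 p.11] -/
theorem reachable_node (x : ray.Node) : ray.subdivision.Reachable (Sum.inl 0) x := by
  have hbf : ∀ n : ℕ, ray.subdivision.Reachable (Sum.inl 0) (Sum.inr (Sum.inr (n, false))) := fun n =>
    (reachable_vertex n).trans
      (ray.subdivision_adj_of_nodeRel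
        (SemiGraph.NodeRel.branch_vertex (G := ray) (n, false) n rfl)).symm.reachable
  have hbt : ∀ n : ℕ, ray.subdivision.Reachable (Sum.inl 0) (Sum.inr (Sum.inr (n, true))) := fun n =>
    (reachable_vertex (n + 1)).trans
      (ray.subdivision_adj_of_nodeRel
        (SemiGraph.NodeRel.branch_vertex (G := ray) (n, true) (n + 1) rfl)).symm.reachable
  rcases x with n | n | ⟨n, c⟩
  · exact reachable_vertex n
  · exact (hbf n).trans
      (ray.subdivision_adj_of_nodeRel (SemiGraph.NodeRel.edge_branch (G := ray) (n, false))).symm.reachable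
  · cases c
    · exact hbf n
    · exact hbt n

/-- `𝒢_ray` is connected. [cite: MochizukiSemiAnbd2006, §1 p.11] -/
theorem coherentRay_isConnected : coherentRay.IsConnected := by
  haveI : Nonempty ray.Node := ⟨Sum.inl 0⟩
  exact ⟨⟨fun x y => (reachable_node x).symm.trans (reachable_node y)⟩⟩

/-- `𝒢_ray` has a vertex. [cite: MochizukiSemiAnbd2006, Prop 3.6 p.38] -/
theorem coherentRay_hasVertex : coherentRay.HasVertex := ⟨(0 : ℕ)⟩

/-- `𝒢_ray` is countable. [cite: MochizukiSemiAnbd2006, §1 p.11] -/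
theorem coherentRay_isCountable : coherentRay.IsCountable := ⟨inferInstance, inferInstance⟩

/-! ### 2. Coherence -/

/-- A finite group is topologically generated by a finite set (all of it).
[cite: MochizukiSemiAnbd2006, Def 2.3(iii) p.25] -/
theorem exists_finset_topologicalClosure_eq_top (K : Type) [Group K] [TopologicalSpace K]
    [IsTopologicalGroup K] [Finite K] :
    ∃ S : Finset K, (Subgroup.closure (S : Set K)).topologicalClosure = ⊤ := by
  classical
  haveI : Fintype K := Fintype.ofFinite K
  refine ⟨Finset.univ, ?_⟩
  rw [Finset.coe_univ, Subgroup.closure_univ]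
  exact top_le_iff.mp (Subgroup.le_topologicalClosure ⊤)

/-- **`𝒢_ray` is quasi-coherent** ([SemiAnbd] Def. 2.3 (iii)): given local coverings `H_n` of degree
`≤ M`, the approximator with vertex groups `Π_{v_n}/Fix(H_n)` (the pointwise stabiliser `Fix(H_n)` has
index `≤ M!`, so all these orders divide `(M!)!`) and trivial edge groups kills every `H_n`.
[cite: MochizukiSemiAnbd2006, Def 2.3(iii) p.25] -/
theorem coherentRay_isQuasiCoherent : coherentRay.IsQuasiCoherent := by
  classical
  intro Mb HV HE hHV _
  haveI : ∀ n : ℕ, Finite (HV n).obj.V := fun n => (hHV n).2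
  let K : ∀ n : ℕ, Subgroup (Fin (n + 1) → M) := fun n => CovObj.fixator (HV n)
  let A : coherentRay.Approximator :=
    { FV := fun n => (Fin (n + 1) → M) ⧸ K n
      FE := fun _ => PUnit
      finiteFV := fun n => Finite.of_surjective _ (QuotientGroup.mk'_surjective (K n))
      πV := fun n => QuotientGroup.mk' (K n)
      πE := fun _ => MonoidHom.id PUnit
      isOpen_ker_πV := fun n => by
        rw [QuotientGroup.ker_mk']
        exact CovObj.isOpen_fixator (HV n)
      isOpen_ker_πE := fun _ => isOpen_discrete _
      brF := fun _ _ _ => 1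
      brF_injective := fun _ _ _ => Function.injective_of_subsingleton _
      comm := fun b v h => ⟨1, fun x => by
        change (1 : (Fin (v + 1) → M) ⧸ K v) = 1 * QuotientGroup.mk' (K v) 1 * 1⁻¹
        simp⟩
      bounded := ⟨(Mb !)!, Nat.factorial_pos _, fun n => by
        change (K n).index ∣ (Mb !)!
        exact Nat.dvd_factorial (Nat.pos_of_ne_zero (CovObj.index_fixator_ne_zero (HV n)))
          ((CovObj.index_fixator_le (HV n)).trans (Nat.factorial_le (hHV n).1))⟩ }
  refine ⟨A, fun n g hg x => ?_, fun e g _ x => ?_⟩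
  · have hmem : g ∈ K n := (QuotientGroup.eq_one_iff g).mp hg
    exact (CovObj.mem_fixator_iff (HV n) g).mp hmem x
  · obtain rfl : g = 1 := Subsingleton.elim _ _
    exact ρ_one_apply _ x

/-- **`𝒢_ray` is coherent** ([SemiAnbd] Def. 2.3 (iii)): quasi-coherent, and its (finite) vertex and
edge groups are topologically finitely generated. [cite: MochizukiSemiAnbd2006, Def 2.3(iii) p.25] -/
theorem coherentRay_isCoherent : coherentRay.IsCoherent :=
  ⟨coherentRay_isQuasiCoherent, fun n => exists_finset_topologicalClosure_eq_top (Fin (n + 1) → M),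
    fun _ => exists_finset_topologicalClosure_eq_top PUnit⟩

/-! ### 3. The diagonal covering and the failure of (T2) -/

/-- `|ℤ/2| = 2`. [cite: MochizukiSemiAnbd2006, Def 2.3(iii) p.25] -/
theorem card_M : Nat.card M = 2 := by
  rw [Nat.card_eq_fintype_card]
  rfl

/-- `|(ℤ/2)^{n+1}| = 2^{n+1}`. [cite: MochizukiSemiAnbd2006, Def 2.3(iii) p.25] -/
theorem card_Gv (n : ℕ) : Nat.card (Fin (n + 1) → M) = 2 ^ (n + 1) := by
  rw [Nat.card_fun, Nat.card_eq_fintype_card (α := Fin (n + 1)), Fintype.card_fin, card_M]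

/-- **Non-free points.**  A point of a finite continuous `Π`-set with fewer points than `Π` has
elements is fixed by some `k ≠ 1` (else `k ↦ k · x` would be injective).
[cite: MochizukiSemiAnbd2006, §3 p.33] -/
theorem exists_ne_one_ρ_eq {G : Type} [Group G] [TopologicalSpace G] (X : BTemp G) [Finite X.obj.V]
    (x : X.obj.V) (hlt : Nat.card X.obj.V < Nat.card G) : ∃ k : G, k ≠ 1 ∧ X.obj.ρ k x = x := by
  by_contra h
  push Not at h
  have hinj : Function.Injective fun k : G => X.obj.ρ k x := by
    intro k k' hkk'
    have hfix : X.obj.ρ (k'⁻¹ * k) x = x := by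
      have hkk'' : X.obj.ρ k x = X.obj.ρ k' x := hkk'
      rw [ρ_mul_apply, hkk'', ← ρ_mul_apply, inv_mul_cancel, ρ_one_apply]
    by_contra hne
    exact h _ (fun h1 => hne (inv_mul_eq_one.mp h1).symm) hfix
  exact absurd (Nat.card_le_card_of_injective _ hinj) (not_le.mpr hlt)

/-- The coordinate character `k ↦ k(c mod (n+1))` of `Π_{v_n} = (ℤ/2)^{n+1}` (any `c : ℕ` names a
coordinate). [cite: MochizukiSemiAnbd2006, Def 3.5(i) p.37] -/
def coordChar (n c : ℕ) : (Fin (n + 1) → M) →* M :=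
  Pi.evalMonoidHom (fun _ : Fin (n + 1) => M) ⟨c % (n + 1), Nat.mod_lt _ (Nat.succ_pos n)⟩

/-- The coordinate characters are continuous. [cite: MochizukiSemiAnbd2006, Def 3.5(i) p.37] -/
theorem continuous_coordChar (n c : ℕ) : Continuous (coordChar n c) :=
  continuous_apply _

/-- The coordinate character named by an honest coordinate `t < n + 1` is evaluation at `t`.
[cite: MochizukiSemiAnbd2006, Def 3.5(i) p.37] -/
theorem coordChar_apply_val (n : ℕ) (t : Fin (n + 1)) (k : Fin (n + 1) → M) :
    coordChar n t.1 k = k t := by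
  change k _ = k t
  exact congrArg k (Fin.ext (Nat.mod_eq_of_lt t.2))

/-- **The diagonal covering.**  For an assignment `c` of a coordinate to every vertex, the finite
object of `B^cov(𝒢_ray)` of degree `2`: over the vertex `n` the set `ℤ/2` with `Π_{v_n}` acting through
the coordinate character `coordChar n (c n)`, over the edges `ℤ/2` with trivial action, identity
gluings (legitimate because the gluings of `𝒢_ray` are trivial). [cite: MochizukiSemiAnbd2006, Def 3.5(i) p.37] -/
def diagObj (c : ℕ → ℕ) : CovObj coherentRay where
  SV n := charObj (K := Fin (n + 1) → M) (coordChar n (c n)) (continuous_coordChar n (c n))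
  SE _ := trivialObj PUnit M
  glue b v h := BTemp.isoOfEquiv (Equiv.refl M) fun g (x : M) => by
    change x = (charObj (K := Fin (v + 1) → M) (coordChar v (c v))
      (continuous_coordChar v (c v))).obj.ρ ((1 : PUnit →ₜ* (Fin (v + 1) → M)) g) x
    rw [charObj_ρ]
    change x = coordChar v (c v) 1 * x
    rw [map_one, one_mul]

/-- The diagonal covering is finite. [cite: MochizukiSemiAnbd2006, Def 3.5(i) p.37] -/
theorem diagObj_isFinite (c : ℕ → ℕ) : (diagObj c).IsFinite :=
  ⟨fun _ => inferInstanceAs (Finite M), fun _ => inferInstanceAs (Finite M)⟩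

/-- The action on the vertex fibres of the diagonal covering, in closed form.
[cite: MochizukiSemiAnbd2006, Def 3.5(i) p.37] -/
theorem diagObj_ρ (c : ℕ → ℕ) (n : ℕ) (k : Fin (n + 1) → M) (x : M) :
    ((diagObj c).SV n).obj.ρ k x = coordChar n (c n) k * x :=
  charObj_ρ (coordChar n (c n)) (continuous_coordChar n (c n)) k x

/-- The vertex selection: given degrees `d_i`, vertices `n_0 < n_1 < ⋯` with `n_i ≥ d_i`.
[cite: Mochizuki2012, IUTchI Rmk 2.5.3 (i) (T2), p. 52] -/
def sel (d : ℕ → ℕ) : ℕ → ℕ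
  | 0 => d 0
  | i + 1 => sel d i + d (i + 1) + 1

/-- `d_i ≤ n_i`. [cite: Mochizuki2012, IUTchI Rmk 2.5.3 (i) (T2), p. 52] -/
theorem le_sel (d : ℕ → ℕ) (i : ℕ) : d i ≤ sel d i := by
  cases i with
  | zero => exact le_rfl
  | succ i =>
    change d (i + 1) ≤ sel d i + d (i + 1) + 1
    omega

/-- The selection is strictly increasing. [cite: Mochizuki2012, IUTchI Rmk 2.5.3 (i) (T2), p. 52] -/
theorem sel_strictMono (d : ℕ → ℕ) : StrictMono (sel d) :=
  strictMono_nat_of_lt_succ fun i => by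
    change sel d i < sel d i + d (i + 1) + 1
    omega

/-- The selection is injective. [cite: Mochizuki2012, IUTchI Rmk 2.5.3 (i) (T2), p. 52] -/
theorem sel_injective (d : ℕ → ℕ) : Function.Injective (sel d) :=
  (sel_strictMono d).injective

/-- **`𝒢_ray` is NOT Galois-countable** (failure of [IUTchI] Rmk. 2.5.3 (i) (T2) for a connected,
countable, coherent semi-graph of anabelioids with a vertex).  DIAGONAL ARGUMENT: given a countable
family `F_i` of finite objects of `B^cov(𝒢_ray)` with nonempty fibres, `F_i` has constant degree `d_i`
(`𝒢_ray` is connected); at the vertex `n_i = sel d i ≥ d_i` (pairwise distinct) the group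
`(ℤ/2)^{n_i+1}` has more than `d_i` elements, so a point `z_i` of `F_i` there is fixed by some
`k_i ≠ 1`, and some coordinate `t_i` has `k_i(t_i) ≠ 1`; the diagonal covering with coordinate `t_i`
at `n_i` is split by no `F_i`, since `k_i` fixes `z_i` but acts as `-1` on its fibre `ℤ/2` over `n_i`.
[cite: Mochizuki2012, IUTchI Rmk 2.5.3 (i) (T2), p. 52] -/
theorem coherentRay_not_isGaloisCountable : ¬ coherentRay.IsGaloisCountable := by
  classical
  rintro ⟨-, F, hF, hsplit⟩
  haveI : ∀ (i n : ℕ), Finite ((F i).SV n).obj.V := fun i n => (hF i).1.finite_V n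
  -- the (constant) degrees
  let d : ℕ → ℕ := fun i => Nat.card ((F i).SV 0).obj.V
  have hd : ∀ i n : ℕ, Nat.card ((F i).SV n).obj.V = d i := fun i n =>
    (F i).nodeCard_eq_of_reachable (reachable_vertex n).symm
  -- at the vertex `sel d i`: a point of `F i`, a non-trivial element fixing it, a coordinate detecting it
  have key : ∀ i : ℕ, ∃ (t : Fin (sel d i + 1)) (z : ((F i).SV (sel d i)).obj.V)
      (k : Fin (sel d i + 1) → M), ((F i).SV (sel d i)).obj.ρ k z = z ∧ k t ≠ 1 := by
    intro i
    obtain ⟨z⟩ := (hF i).2.nonempty_V (sel d i)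
    have hlt : Nat.card ((F i).SV (sel d i)).obj.V < Nat.card (Fin (sel d i + 1) → M) := by
      rw [hd, card_Gv]
      exact (le_sel d i).trans_lt
        ((Nat.lt_succ_self _).trans (Nat.lt_two_pow_self))
    obtain ⟨k, hk1, hkz⟩ := exists_ne_one_ρ_eq ((F i).SV (sel d i)) z hlt
    obtain ⟨t, ht⟩ : ∃ t : Fin (sel d i + 1), k t ≠ 1 := by
      by_contra h
      push Not at h
      exact hk1 (funext h)
    exact ⟨t, z, k, hkz, ht⟩
  choose t z k hkz hkt using key
  -- the diagonal assignment of coordinates: `t i` at the vertex `sel d i`, anything elsewhere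
  let c : ℕ → ℕ := fun m => if h : ∃ i, sel d i = m then (t h.choose).1 else 0
  have hc : ∀ i : ℕ, c (sel d i) = (t i).1 := by
    intro i
    have h : ∃ j, sel d j = sel d i := ⟨i, rfl⟩
    have hci : c (sel d i) = (t h.choose).1 := dif_pos h
    rw [hci, sel_injective d h.choose_spec]
  obtain ⟨i, hiV, -⟩ := hsplit (diagObj c) (diagObj_isFinite c)
  have h := hiV (sel d i) (z i) (k i) (hkz i) (1 : M)
  rw [diagObj_ρ, mul_one, hc, coordChar_apply_val] at h
  exact hkt i h

/-- `𝒢_ray` is NOT strictly coherent — necessarily, by (T4)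
(`isGaloisCountable_of_isStrictlyCoherent`); concretely, the vertex groups `(ℤ/2)^{n+1}` need `n + 1`
topological generators, unboundedly many. [cite: Mochizuki2012, IUTchI Rem. 2.5.3(i)(T3) p.53] -/
theorem coherentRay_not_isStrictlyCoherent : ¬ coherentRay.IsStrictlyCoherent := fun h =>
  coherentRay_not_isGaloisCountable
    (isGaloisCountable_of_isStrictlyCoherent coherentRay_isConnected coherentRay_hasVertex
      coherentRay_isCountable h)

/-! ### 4. Records: "strictly" cannot be dropped in (T4) -/

/-- **The countermodel, packaged**: a connected, countable, coherent semi-graph of anabelioids with a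
vertex which is neither strictly coherent nor Galois-countable.
[cite: Mochizuki2012, IUTchI Rem. 2.5.3(i)(T4) p.53] -/
theorem exists_isCoherent_not_isGaloisCountable :
    ∃ 𝒢 : ProfiniteSemiGraph.{0}, 𝒢.IsConnected ∧ 𝒢.HasVertex ∧ 𝒢.IsCountable ∧ 𝒢.IsCoherent ∧
      ¬ 𝒢.IsStrictlyCoherent ∧ ¬ 𝒢.IsGaloisCountable :=
  ⟨coherentRay, coherentRay_isConnected, coherentRay_hasVertex, coherentRay_isCountable,
    coherentRay_isCoherent, coherentRay_not_isStrictlyCoherent, coherentRay_not_isGaloisCountable⟩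

/-- **"Strictly" cannot be dropped in [IUTchI] Rmk. 2.5.3 (i) (T4)** as typed
(`ProfiniteSemiGraph.isGaloisCountable_of_isStrictlyCoherent`): the universally quantified statement
"connected, with a vertex, countable, COHERENT ⇒ Galois-countable" is FALSE.  (Print's (T4) asserts
the strictly coherent case only — proved in the tree; this is a tightness datum about the hypothesis.)
[cite: Mochizuki2012, IUTchI Rem. 2.5.3(i)(T4) p.53] -/
theorem not_forall_isCoherent_isGaloisCountable :
    ¬ ∀ 𝒢 : ProfiniteSemiGraph.{0}, 𝒢.IsConnected → 𝒢.HasVertex → 𝒢.IsCountable → 𝒢.IsCoherent →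
        𝒢.IsGaloisCountable := fun h =>
  coherentRay_not_isGaloisCountable
    (h coherentRay coherentRay_isConnected coherentRay_hasVertex coherentRay_isCountable
      coherentRay_isCoherent)

end CoherentRay

end ProfiniteSemiGraph

end Literature.AnabelianGeometry.SemiGraphs
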